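import Summits.Ventures.PackingBounds.Energy.UniversalOptimality
import Mathlib.Analysis.SpecialFunctions.Pow.Deriv

/-!
# Inverse power laws are absolutely monotonic; E₈, the Leech lattice and the 600-cell minimise
every Riesz energy

Framing: lottery ticket; floor = certified bounds/negative ranges. Venture `PackingBounds` (cell
`pub-packcert`, seat `pub-packcert-energy`), energy-minimisation family — a corollary file.

For a unit-vector configuration the Riesz `s`-energy is `Σ_{x ≠ y} |x - y|^{-s} = Σ_{x ≠ y}
(2 - 2⟨x,y⟩)^{-s/2}`. The potential `a_p(t) = (2 - 2t)^{-p}`, `p ≥ 0`, is absolutely monotonic on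
`[-1,1)`: its `k`-th derivative is `2^k p (p+1)⋯(p+k-1) (2-2t)^{-p-k} ≥ 0`
(`absolutelyMonotoneOn_rpow_chordal`). Hence, by the universal-optimality theorems of
`UniversalOptimality.lean` (Cohn–Kumar 2007, Thm. 1.2, kernel-checked there), the `E₈` roots, the Leech
minimal vectors and the regular 600-cell minimise the Riesz `s`-energy for EVERY `s > 0` among
configurations of their size (`riesz_energy_ge_E8`, `_Leech`, `_SixHundredCell`), with the explicit
minimal value. (The cell's earlier files `DimensionEight.lean`, `…Riesz4/6`, `CoulombDimension…`
are the cases `s = 2, 4, 6, 1` with rational / radical constants.)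

## References
* H. Cohn, A. Kumar, *Universally optimal distribution of points on spheres*, J. Amer. Math. Soc.
  20 (2007) 99–148, Theorem 1.2 (and p. 5 for inverse power laws). [`CohnKumar2006`]
-/

noncomputable section

namespace Summit.Ventures.PackingBounds.Energy

open Finset Set
open scoped ContDiff

namespace RieszAbsolutelyMonotone

/-- Closed form of the iterated derivatives of `t ↦ (2 - 2t)^{-p}` on `t < 1`:
`a^{(k)}(x) = (2^k ∏_{i<k} (p+i)) (2 - 2x)^{-p-k}`. [folklore] -/
private theorem iteratedDeriv_rpow_chordal (p : ℝ) (k : ℕ) :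
    ∀ x : ℝ, x < 1 → iteratedDeriv k (fun t : ℝ => (2 - 2 * t) ^ (-p)) x =
      (2 ^ k * ∏ i ∈ range k, (p + i)) * (2 - 2 * x) ^ (-p - k) := by
  induction k with
  | zero => intro x _; simp
  | succ k ih =>
    intro x hx
    rw [iteratedDeriv_succ]
    -- near `x` the `k`-th derivative is the closed form
    have hev : iteratedDeriv k (fun t : ℝ => (2 - 2 * t) ^ (-p)) =ᶠ[nhds x]
        fun y => (2 ^ k * ∏ i ∈ range k, (p + i)) * (2 - 2 * y) ^ (-p - k) := by
      have hopen : IsOpen (Iio (1 : ℝ)) := isOpen_Iio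
      filter_upwards [hopen.mem_nhds hx] with y hy using ih y hy
    rw [hev.deriv_eq]
    have h2x : (2 : ℝ) - 2 * x ≠ 0 := by linarith
    have hlin : HasDerivAt (fun y : ℝ => 2 - 2 * y) (-2) x := by
      simpa using ((hasDerivAt_id x).const_mul (2 : ℝ)).const_sub 2
    have hpow := hlin.rpow_const (p := -p - k) (Or.inl h2x)
    have hder := hpow.const_mul (2 ^ k * ∏ i ∈ range k, (p + i))
    rw [hder.deriv, Finset.prod_range_succ]
    have hsplit : (2 - 2 * x) ^ (-p - (k : ℝ) - 1) = (2 - 2 * x) ^ (-p - ((k + 1 : ℕ) : ℝ)) := by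
      congr 1; push_cast; ring
    rw [hsplit]
    ring

/-- **Inverse power laws are absolutely monotonic**: for `p ≥ 0`, `t ↦ (2 - 2t)^{-p}` (`= |x-y|^{-2p}`
at `t = ⟨x,y⟩`) is absolutely monotonic on `[-1, 1)` in Mathlib's sense. [folklore] -/
theorem absolutelyMonotoneOn_rpow_chordal (p : ℝ) (hp : 0 ≤ p) :
    AbsolutelyMonotoneOn (fun t : ℝ => (2 - 2 * t) ^ (-p)) (Ico (-1) 1) := by
  have hS := uniqueDiffOn_Ico (-1 : ℝ) 1
  have hcd : ∀ x : ℝ, x < 1 → ContDiffAt ℝ ∞ (fun t : ℝ => (2 - 2 * t) ^ (-p)) x := by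
    intro x hx
    have h2x : (2 : ℝ) - 2 * x ≠ 0 := by linarith
    exact (Real.contDiffAt_rpow_const_of_ne (p := -p) h2x).comp x
      ((contDiffAt_const.sub (contDiffAt_const.mul contDiffAt_id)))
  rw [AbsolutelyMonotoneOn.iff_iteratedDerivWithin_nonneg hS]
  refine ⟨fun x hx => (hcd x hx.2).contDiffWithinAt, fun n x hx => ?_⟩
  rw [iteratedDerivWithin_eq_iteratedDeriv hS ((hcd x hx.2).of_le (mod_cast le_top)) hx,
    iteratedDeriv_rpow_chordal p n x hx.2]
  have h2x : (0 : ℝ) < 2 - 2 * x := by linarith [hx.2]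
  have hprod : 0 ≤ ∏ i ∈ range n, (p + i) := Finset.prod_nonneg fun i _ => by positivity
  have hpow : 0 ≤ (2 - 2 * x) ^ (-p - n) := Real.rpow_nonneg h2x.le _
  positivity

end RieszAbsolutelyMonotone

open RieszAbsolutelyMonotone

open scoped Classical in
/-- **`E₈` minimises every Riesz energy** among 240-point configurations on `S⁷`: for all `p ≥ 0`,
`Σ_{x ≠ y} (2 - 2⟨x,y⟩)^{-p} ≥ 240 (4^{-p} + 56 · 3^{-p} + 126 · 2^{-p} + 56)` — the value at the E₈
roots (`|x-y|^{-2p}`-energy; inner products `-1, ±1/2, 0`). [cite: CohnKumar2006, Theorem 1.2] -/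
theorem riesz_energy_ge_E8 (p : ℝ) (hp : 0 ≤ p) (C : Finset (EuclideanSpace ℝ (Fin 8)))
    (h1 : ∀ x ∈ C, ‖x‖ = 1) (hN : C.card = 240) :
    (240 : ℝ) * ((4 : ℝ) ^ (-p) + 56 * (3 : ℝ) ^ (-p) + 126 * (2 : ℝ) ^ (-p) + 56) ≤
      ∑ x ∈ C, ∑ y ∈ C.erase x, (2 - 2 * inner ℝ x y) ^ (-p) := by
  have h := UniversalE8.universallyOptimal_of_absolutelyMonotoneOn (fun t : ℝ => (2 - 2 * t) ^ (-p))
    (absolutelyMonotoneOn_rpow_chordal p hp) C h1 hN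
  refine le_trans (le_of_eq ?_) h
  norm_num

open scoped Classical in
/-- **The Leech lattice minimal vectors minimise every Riesz energy** among 196560-point
configurations on `S²³`: for all `p ≥ 0`, `Σ_{x ≠ y} (2 - 2⟨x,y⟩)^{-p} ≥ 196560 (4^{-p} + 4600 · 3^{-p}
+ 47104 · (5/2)^{-p} + 93150 · 2^{-p} + 47104 · (3/2)^{-p} + 4600)`. [cite: CohnKumar2006, Theorem 1.2] -/
theorem riesz_energy_ge_Leech (p : ℝ) (hp : 0 ≤ p) (C : Finset (EuclideanSpace ℝ (Fin 24)))
    (h1 : ∀ x ∈ C, ‖x‖ = 1) (hN : C.card = 196560) :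
    (196560 : ℝ) * ((4 : ℝ) ^ (-p) + 4600 * (3 : ℝ) ^ (-p) + 47104 * (5 / 2 : ℝ) ^ (-p)
        + 93150 * (2 : ℝ) ^ (-p) + 47104 * (3 / 2 : ℝ) ^ (-p) + 4600) ≤
      ∑ x ∈ C, ∑ y ∈ C.erase x, (2 - 2 * inner ℝ x y) ^ (-p) := by
  have h := UniversalLeech.universallyOptimal_of_absolutelyMonotoneOn
    (fun t : ℝ => (2 - 2 * t) ^ (-p)) (absolutelyMonotoneOn_rpow_chordal p hp) C h1 hN
  refine le_trans (le_of_eq ?_) h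
  norm_num

open scoped Classical in
/-- **The regular 600-cell minimises every Riesz energy** among 120-point configurations on `S³`:
for all `p ≥ 0`, `Σ_{x ≠ y} (2 - 2⟨x,y⟩)^{-p} ≥` its value at the 600-cell (inner products
`-1, (-1-√5)/4, -1/2, (1-√5)/4, 0, (√5-1)/4, 1/2, (1+√5)/4` with multiplicities
`1, 12, 20, 12, 30, 12, 20, 12`). [cite: CohnKumar2006, Theorem 1.2] -/
theorem riesz_energy_ge_SixHundredCell (p : ℝ) (hp : 0 ≤ p)
    (C : Finset (EuclideanSpace ℝ (Fin 4))) (h1 : ∀ x ∈ C, ‖x‖ = 1) (hN : C.card = 120) :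
    (120 : ℝ) * ((4 : ℝ) ^ (-p) + 12 * (2 - 2 * ((-1 / 4 : ℝ) + (-1 / 4 : ℝ) * Real.sqrt 5)) ^ (-p)
        + 20 * (3 : ℝ) ^ (-p) + 12 * (2 - 2 * ((1 / 4 : ℝ) + (-1 / 4 : ℝ) * Real.sqrt 5)) ^ (-p)
        + 30 * (2 : ℝ) ^ (-p) + 12 * (2 - 2 * ((-1 / 4 : ℝ) + (1 / 4 : ℝ) * Real.sqrt 5)) ^ (-p)
        + 20 * (1 : ℝ) ^ (-p) + 12 * (2 - 2 * ((1 / 4 : ℝ) + (1 / 4 : ℝ) * Real.sqrt 5)) ^ (-p)) ≤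
      ∑ x ∈ C, ∑ y ∈ C.erase x, (2 - 2 * inner ℝ x y) ^ (-p) := by
  have h := UniversalSixHundredCell.universallyOptimal_of_absolutelyMonotoneOn
    (fun t : ℝ => (2 - 2 * t) ^ (-p)) (absolutelyMonotoneOn_rpow_chordal p hp) C h1 hN
  refine le_trans (le_of_eq ?_) h
  norm_num

open scoped Classical in
/-- **The regular icosahedron minimises every Riesz energy** among 12-point configurations on `S²`
(for `p = 1/2` this is the Thomson problem for `N = 12`, Andreev 1996): for all `p ≥ 0`,
`Σ_{x ≠ y} (2 - 2⟨x,y⟩)^{-p} ≥ 12 (4^{-p} + 5 (2 + 2/√5)^{-p} + 5 (2 - 2/√5)^{-p})`.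
[cite: CohnKumar2006, Theorem 1.2] -/
theorem riesz_energy_ge_Icosahedron (p : ℝ) (hp : 0 ≤ p)
    (C : Finset (EuclideanSpace ℝ (Fin 3))) (h1 : ∀ x ∈ C, ‖x‖ = 1) (hN : C.card = 12) :
    (12 : ℝ) * ((4 : ℝ) ^ (-p) + 5 * (2 - 2 * (-(Real.sqrt 5 / 5))) ^ (-p)
        + 5 * (2 - 2 * (Real.sqrt 5 / 5)) ^ (-p)) ≤
      ∑ x ∈ C, ∑ y ∈ C.erase x, (2 - 2 * inner ℝ x y) ^ (-p) := by
  have h := UniversalIcosahedron.universallyOptimal_of_absolutelyMonotoneOn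
    (fun t : ℝ => (2 - 2 * t) ^ (-p)) (absolutelyMonotoneOn_rpow_chordal p hp) C h1 hN
  refine le_trans (le_of_eq ?_) h
  norm_num

open scoped Classical in
/-- **Regular simplices minimise every Riesz energy** (`N ≤ n + 1`; for general `N ≥ 2` the bound
still holds): for `n ≥ 3`, `N ≥ 2`, `p ≥ 0`, every `N`-point configuration of unit vectors in `ℝⁿ` has
`Σ_{x ≠ y} (2 - 2⟨x,y⟩)^{-p} ≥ N (N-1) (2 + 2/(N-1))^{-p}`. [cite: CohnKumar2006, Theorem 1.2] -/
theorem riesz_energy_ge_simplex {n : ℕ} (hn : 3 ≤ n) {N : ℕ} (hN2 : 2 ≤ N) (p : ℝ) (hp : 0 ≤ p)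
    (C : Finset (EuclideanSpace ℝ (Fin n))) (h1 : ∀ x ∈ C, ‖x‖ = 1) (hN : C.card = N) :
    (N : ℝ) * (((N : ℝ) - 1) * (2 - 2 * (-1 / ((N : ℝ) - 1))) ^ (-p)) ≤
      ∑ x ∈ C, ∑ y ∈ C.erase x, (2 - 2 * inner ℝ x y) ^ (-p) :=
  UniversalSimplex.universallyOptimal_of_absolutelyMonotoneOn hn hN2
    (fun t : ℝ => (2 - 2 * t) ^ (-p)) (absolutelyMonotoneOn_rpow_chordal p hp) C h1 hN

open scoped Classical in
/-- **Regular cross-polytopes minimise every Riesz energy** among `2n`-point configurations on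
`S^{n-1}`, `n ≥ 3`: for `p ≥ 0`, `Σ_{x ≠ y} (2 - 2⟨x,y⟩)^{-p} ≥ 2n (4^{-p} + (2n-2) 2^{-p})`.
[cite: CohnKumar2006, Theorem 1.2] -/
theorem riesz_energy_ge_crossPolytope {n : ℕ} (hn : 3 ≤ n) (p : ℝ) (hp : 0 ≤ p)
    (C : Finset (EuclideanSpace ℝ (Fin n))) (h1 : ∀ x ∈ C, ‖x‖ = 1) (hN : C.card = 2 * n) :
    (2 * n : ℝ) * ((4 : ℝ) ^ (-p) + (2 * n - 2) * (2 : ℝ) ^ (-p)) ≤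
      ∑ x ∈ C, ∑ y ∈ C.erase x, (2 - 2 * inner ℝ x y) ^ (-p) := by
  have h := UniversalCrossPolytope.universallyOptimal_of_absolutelyMonotoneOn hn
    (fun t : ℝ => (2 - 2 * t) ^ (-p)) (absolutelyMonotoneOn_rpow_chordal p hp) C h1 hN
  refine le_trans (le_of_eq ?_) h
  norm_num

end Summit.Ventures.PackingBounds.Energy

end
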